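import Literature.AnabelianGeometry.EtaleTheta.Discharge.Sec2Cor28iiiInnerOfEmbedding
import HarnessLib

/-!
# [EtTh] Cor 2.8 (i) at the §1 model, INNER case: an inner automorphism from `Π^tp_{X̲̲}` acts on the orbit
# data `ThetaOrbitData.ofEmbedding` WITHOUT constant multiple (all four conclusions of `Cor28_i`)

Mochizuki, *The Étale Theta Function …* [EtTh], Publ. RIMS 45 (2009), §2, Cor 2.8 (i), (iii), PRIMS PDF
p.42 (bib key `MochizukiEtTh2009`): (i) "`γ` preserves the property that `η̲̈^{Θ,l·ℤ×μ₂}` (resp. …) be of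
standard type — a property that determines this collection of classes up to multiplication by a root of
unity of order `l` (resp. `1`; `l`; `1`)"; (iii) for INNER `γ` "without any constant multiple indeterminacy".

PROOF-ONLY companion (no `def`; seat abc-iut-L2-t2) of `ThetaRootOrbits.lean` /
`ThetaRootOrbitsOfSetting.lean` / `Discharge/Sec2Cor28iiiInnerOfEmbedding.lean`. Two generic facts about
the interface `ThetaCovers.ThetaOrbitData` — `twist_one` (twisting by the trivial cocycle is the identity)
and `eqUpToRootOfUnity_refl` (`EqUpToRootOfUnity n H C C`: the relation "equal up to a root of unity of
order `n`" is reflexive, witnessed by `κ = 1`) — and the INNER case of Cor 2.8 (i) for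
`O = ThetaOrbitData.ofEmbedding ε hC hS`: for `x ∈ Π^tp_{X̲̲}` of `T` (`x = ι σ`, `σ ∈ C.Huu`) and `Γ_Θ`
induced by the inner automorphism `γ_x`, the transports of `η̈^{Θ,ℤ×μ₂}`, `η̈^{Θ,l·ℤ×μ₂}`, `η̲̈^{Θ,l·ℤ×μ₂}` are
these collections themselves (`Sec2Cor28iiiInnerOfEmbedding` + `ofEmbedding_transport_inner_etaLZMu2`
here), so all four conclusions of `ThetaOrbitData.Cor28_i` hold for `γ_x` — with NO `Dtau`-stability or
tower hypothesis and the standard-type hypothesis used only for the first (`ofEmbedding_cor28_i_inner`).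
The non-inner case (general `γ`, [EtTh] Thm 1.10 by name) is not addressed. HONEST FRAMING: [EtTh] is
refereed; no side is taken on [IUTchIII] Cor 3.12; nothing beyond the displayed statements is claimed.
-/

noncomputable section

namespace Literature.AnabelianGeometry.EtaleTheta

open Literature.AnabelianGeometry.SemiGraphs ThetaCovers

universe u

namespace ThetaCovers.ThetaOrbitData

/-! ### Two generic facts about `twist` / `EqUpToRootOfUnity` -/

section generic

variable {l : ℕ} {T : TemperedCoverData.{u} l} (O : ThetaOrbitData T)

/-- Twisting a collection by the trivial function is the identity. [cite: MochizukiEtTh2009, Cor 2.8(i) p.42] -/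
theorem twist_one (H : Subgroup T.Gtp) (C : Set (Set (↥H → O.DeltaTheta))) : O.twist H 1 C = C := by
  simp only [ThetaOrbitData.twist, Pi.one_apply, mul_one, Set.image_id']

/-- "Equal up to multiplication by a root of unity of order `n`" is reflexive (witness: the trivial
cocycle `κ = 1`, `κ^n = ∂1`). [cite: MochizukiEtTh2009, Cor 2.8(i) p.42] -/
theorem eqUpToRootOfUnity_refl (n : ℕ) (H : Subgroup T.Gtp) (C : Set (Set (↥H → O.DeltaTheta))) :
    O.EqUpToRootOfUnity n H C C :=
  ⟨1, fun _ _ _ => rfl, fun x y => by simp only [Pi.one_apply, map_one, mul_one],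
    ⟨1, fun x => by simp only [Pi.one_apply, one_pow, map_one, inv_one, mul_one]⟩, (O.twist_one H C).symm⟩

end generic

/-! ### The inner case of Cor 2.8 (i) for `ofEmbedding` -/

variable {p : ℕ} [Fact p.Prime] {D : ThetaSetting p} {E : D.EtaleThetaData} {l : ℕ}
  {C : E.DoubleUnderline l} {T : TemperedCoverData.{u} l} (ε : C.OrbitEmbedding T)

/-- `(γ_x, Γ_Θ) · η̈^{Θ,l·ℤ×μ₂} = η̈^{Θ,l·ℤ×μ₂}` for every `x ∈ ι(Π^tp_{X̲})` (the `Π^tp_{X̲}`-orbit is an orbit,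
p.41). [cite: MochizukiEtTh2009, Def 2.7 p.41] -/
theorem ofEmbedding_transport_inner_etaLZMu2 (hC : D.Compat) (hS : D.Sec2Hyps) {x : T.Gtp}
    (hx : x ∈ (D.GtpXu l).map ε.ι)
    (ΓΘ : (ofEmbedding ε hC hS).DeltaTheta ≃* (ofEmbedding ε hC hS).DeltaTheta)
    (hind : (ofEmbedding ε hC hS).InducesOnTheta (innerAutTop x) ΓΘ)
    (hY : T.PiYddtp.map (innerAutTop x).toMulEquiv.toMonoidHom = T.PiYddtp) :
    (ofEmbedding ε hC hS).transport _ (innerAutTop x) hY ΓΘ (ofEmbedding ε hC hS).etaLZMu2 =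
      (ofEmbedding ε hC hS).etaLZMu2 := by
  haveI := hC.GtpYdd_normal
  haveI : ε.bot.Normal := ε.normal_bot
  obtain ⟨σ, hσ, rfl⟩ := Subgroup.mem_map.1 hx
  have hΘ := ε.symm_coeffOf_of_induces hC hS σ ΓΘ hind
  exact ε.image_orbitColl_eq hC σ ΓΘ hΘ (ε.conj_mem_PiYddtp σ) (S := (D.GtpXu l : Set D.PiTemp))
    (fun s hs => (D.GtpXu l).mul_mem ((D.GtpXu l).inv_mem hσ) hs) (fun s hs => (D.GtpXu l).mul_mem hσ hs)

/-- **Cor 2.8 (i), INNER case (at `ofEmbedding`)**: for `x ∈ Π^tp_{X̲̲}` of `T` and `Γ_Θ` induced by the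
inner automorphism `γ_x`, ALL FOUR conclusions of `ThetaOrbitData.Cor28_i` hold for `(γ_x, Γ_Θ)` — the
transport of `η̈^{Θ,ℤ×μ₂}` is of standard type (it IS `η̈^{Θ,ℤ×μ₂}`), and `η̲̈^{Θ,l·ℤ×μ₂}`, `η̈^{Θ,ℤ×μ₂}`,
`η̈^{Θ,l·ℤ×μ₂}` agree with their transports up to a root of unity of order `l`, `1`, `1` (indeed exactly:
Cor 2.8 (iii)'s "without any constant multiple indeterminacy") — no `Dtau`-stability or tower hypothesis
is needed in the inner case. [cite: MochizukiEtTh2009, Cor 2.8(i) p.42] -/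
theorem ofEmbedding_cor28_i_inner (hC : D.Compat) (hS : D.Sec2Hyps)
    (hstd : (ofEmbedding ε hC hS).IsStandard) {x : T.Gtp} (hx : x ∈ T.tp T.PiXuu)
    (ΓΘ : (ofEmbedding ε hC hS).DeltaTheta ≃* (ofEmbedding ε hC hS).DeltaTheta)
    (hind : (ofEmbedding ε hC hS).InducesOnTheta (innerAutTop x) ΓΘ)
    (hY : T.PiYddtp.map (innerAutTop x).toMulEquiv.toMonoidHom = T.PiYddtp)
    (hYuu : (T.PiYddtp ⊓ T.tp T.PiXuu).map (innerAutTop x).toMulEquiv.toMonoidHom =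
      T.PiYddtp ⊓ T.tp T.PiXuu) :
    (ofEmbedding ε hC hS).IsStandardColl
        ((ofEmbedding ε hC hS).transport _ (innerAutTop x) hY ΓΘ (ofEmbedding ε hC hS).etaZMu2) ∧
      (ofEmbedding ε hC hS).EqUpToRootOfUnity l _ (ofEmbedding ε hC hS).rootLZMu2
        ((ofEmbedding ε hC hS).transport _ (innerAutTop x) hYuu ΓΘ (ofEmbedding ε hC hS).rootLZMu2) ∧
      (ofEmbedding ε hC hS).EqUpToRootOfUnity 1 _ (ofEmbedding ε hC hS).etaZMu2
        ((ofEmbedding ε hC hS).transport _ (innerAutTop x) hY ΓΘ (ofEmbedding ε hC hS).etaZMu2) ∧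
      (ofEmbedding ε hC hS).EqUpToRootOfUnity 1 _ (ofEmbedding ε hC hS).etaLZMu2
        ((ofEmbedding ε hC hS).transport _ (innerAutTop x) hY ΓΘ (ofEmbedding ε hC hS).etaLZMu2) := by
  have hxX : x ∈ (⊤ : Subgroup D.PiTemp).map ε.ι :=
    Subgroup.map_mono le_top (ε.map_Huu.ge hx)
  have hxXu : x ∈ (D.GtpXu l).map ε.ι := Subgroup.map_mono C.Huu_le_GtpXu (ε.map_Huu.ge hx)
  rw [ofEmbedding_transport_inner_etaZMu2 ε hC hS hxX ΓΘ hind hY,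
    ofEmbedding_transport_inner_rootLZMu2 ε hC hS hx ΓΘ hind hYuu,
    ofEmbedding_transport_inner_etaLZMu2 ε hC hS hxXu ΓΘ hind hY]
  exact ⟨hstd, eqUpToRootOfUnity_refl _ _ _ _, eqUpToRootOfUnity_refl _ _ _ _,
    eqUpToRootOfUnity_refl _ _ _ _⟩

end ThetaCovers.ThetaOrbitData

end Literature.AnabelianGeometry.EtaleTheta

end

-- (re-land 2026-08-26T07:58Z: enqueue build after the ThetaCovers v3 reload window; declarations byte-identical)
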